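import Literature.AnabelianGeometry.SemiGraphs.OncePuncturedTemperedGroupWitness
import Literature.AnabelianGeometry.SemiGraphs.TemperedCurveHyperbolicWitness
import Literature.AnabelianGeometry.SemiGraphs.TemperedCurveGalois
import Literature.AnabelianGeometry.AbsoluteAnabelian.SubpadicSlimProofs
import Literature.AnabelianGeometry.AbsoluteAnabelian.SubpadicExamples
import Literature.NumberTheory.LocalFields.PadicGaloisSecondCountable
import HarnessLib

/-!
# `GroupLevelData` with GENUINE arithmetic part AND nonabelian slim geometric part, at a §6 datum
# with a cusp ([SemiAnbd] Ex. 3.10 / §6 pp. 69–71) — non-vacuity, second witness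

Mochizuki, *Semi-graphs of anabelioids*, Publ. RIMS **42** (2006) [SemiAnbd], Example 3.10 pp. 43–45
("`1 → Δ → Π → G_K → 1` … both `Δ` and `Π` are temp-slim") and §6 pp. 69–71 (the interface
`TemperedCurve p`: "`D_x` always surjects onto an open subgroup of `G_K`", "`I_x` is isomorphic to
`Ẑ(1)` if `x` is a cusp"). [cite: MochizukiSemiAnbd2006, Ex 3.10 pp.43-45]
[cite: MochizukiSemiAnbd2006, §6 pp.69-71]

PROOF-ONLY non-vacuity file (abc-iut cell, NV lane, prover abc-iut-w5-d040, additive sequel to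
abc-iut-w5-d149's `TemperedCurveDataNonVacuity.lean` with the row holder's consent; no definition, no
instance).  `TemperedCurve.GroupLevelData` (abc-iut-w5-d111: `G_K ≃ Gal(K̄/K)`, "`Π`, `Δ` tempered",
"`Π`, `Δ` temp-slim", "`Π` Galois-countable") was so far inhabited only at `TemperedCurve.degenerate p`
(`Π = G_{ℚ_p}`, `Δ = 1`), and every §6 datum in the tree is degenerate on one side (`toyHyperbolic`: `Ẑ`
central in `Δ`; abc-iut-w5-d240's tower witness: no closed points; abc-iut-w5-d218's model: `G_K = 1`,
cusps `{⊥}`).  Here: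

* `isSlimGroup_profiniteCompletion_freeGroupTwo` — **`F̂₂` is slim** (the profinite completion of the
  free group on two generators; from abc-iut-w5-d218's centraliser technology for `F̂₂ ×_{Ẑ} ℤ`:
  centralisers of `η(b^m)` lie in `cl η⟨b⟩ = îb(Ẑ)`, then evaluate the completed exponent sums);
* `isSlimGroup_prod_of_profinite` — a product of two slim profinite groups is slim;
* `exists_temperedCurve_groupLevelData_genuine` — **a `TemperedCurve p` over `K = ℚ_p` with
  `Π^temp := G_{ℚ_p} × F̂₂`** (augmentation the first projection, itself as profinite completion), ONE
  closed point, a CUSP, with `D_x := G_{ℚ_p} × îa(Ẑ)` (`îa` the completion of `k ↦ a^k`), so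
  `aug(D_x) = G_{ℚ_p}` (open) and `I_x = 1 × îa(Ẑ) ≃ₜ* Ẑ` (via the completed exponent sum `ê_a`,
  `ê_a ∘ îa = id`), **carrying `GroupLevelData` UNCONDITIONALLY** (`galEquiv` = G11
  `galoisIdentification`; `Π`, `Δ` tempered: profinite, Rmk. 3.1.1; `Π` slim: `G_{ℚ_p}` by [pGC] Lem.
  15.8 PROVED in the tree + `F̂₂` here + products; `Δ ≅ F̂₂` slim; Galois-countable: Krasner finiteness
  for `G_{ℚ_p}`, abc-iut-w5-d218 for `F̂₂`) — with `Δ^temp` NONABELIAN, a cusp, `aug` onto `G_{ℚ_p}`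
  (`G_K ≠ 1`: arithmetic GENUINE), and via the bridge `toTemperedArithmeticGroup` (ruling η) a
  `TemperedArithmeticGroup` of Ex. 3.10 over `ℚ_p` with nonabelian slim `Δ`.

HONEST LIMITS.  Consistency evidence for the interfaces only — NOT André's `π₁^temp` of a curve:
`Π^temp` is a direct product (so `Δ^temp` is a direct factor and `D_x ⊇ 1 × I_x` has normaliser
containing `G_{ℚ_p} × N(îa(Ẑ))`; Thm. 6.5 (ii) `DecompCommensurablyTerminal` is not claimed), `Π^temp`
is compact (profinite, "tempered" only via Rmk. 3.1.1), there is exactly one closed point, and the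
cuspidal inertia `I_x = îa(Ẑ)` is topologically generated by the image of a free GENERATOR `a` of `F₂`,
whereas for a once-punctured elliptic curve (`Δ̂ ≅ F̂₂`) the cuspidal inertia is generated by a
commutator — no curve is asserted to realise this datum.  Nothing of [SemiAnbd] is asserted; no side is
taken on [IUTchIII] Cor. 3.12.
-/

noncomputable section

open Topology Filter Set Function
open Literature.IUT.HodgeTheaters (profiniteCompletion toCompletion toCompletion_int_injective)
open Literature.AlgebraicGeometry.Frobenioids (IsSlimGroup)
open Literature.AnabelianGeometry.AbsoluteAnabelian

namespace Literature.AnabelianGeometry.SemiGraphs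

/-! ### `F̂₂` is slim -/

/-- **The profinite completion `F̂₂` of the free group on two generators is slim**: an open subgroup
`U ≤ F̂₂` contains an open normal `V`, whose trace `M = η⁻¹(V) ⊴ F₂` has finite index `m`, so
`η(b^m), η(a b^m a⁻¹) ∈ U`; an element `z` centralising `U` centralises `η(b^m)`, hence lies in
`cl η⟨b⟩ = îb(Ẑ)` (abc-iut-L5-d2's centraliser condition + Magnus–Karrass–Solitar 4.1.6, packaged by
abc-iut-w5-d218 as `TemperedFibreProduct.centralizer_eta_of_zpow_subset`), and so does
`η(a)⁻¹ z η(a)`; evaluating the completed exponent sum `ê_b` (`ê_b ∘ îb = id`, `ê_b(η a) = 1`) shows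
`z` commutes with `η a`, so `z ∈ cl η⟨a⟩ = îa(Ẑ)`; evaluating `ê_a` (`ê_a ∘ îa = id`, `ê_a ∘ îb = 1`)
gives `z = 1`. ([SemiAnbd] Ex. 3.10 p. 45 "temp-slim", for the model group.)
[cite: MochizukiSemiAnbd2006, Ex 3.10 p.45] -/
theorem isSlimGroup_profiniteCompletion_freeGroupTwo :
    IsSlimGroup (profiniteCompletion (FreeGroup (Fin 2))) := by
  classical
  -- notation and the completed exponent sums / one-parameter subgroups (as in abc-iut-w5-d218's witness)
  let P : ProfiniteGrp.{0} := profiniteCompletion (FreeGroup (Fin 2))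
  let Zh : ProfiniteGrp.{0} := profiniteCompletion (Multiplicative ℤ)
  let η : FreeGroup (Fin 2) →* P := toCompletion (FreeGroup (Fin 2))
  let ι : Multiplicative ℤ →* Zh := toCompletion (Multiplicative ℤ)
  let a : FreeGroup (Fin 2) := FreeGroup.of 0
  let b : FreeGroup (Fin 2) := FreeGroup.of 1
  let σa : FreeGroup (Fin 2) →* Multiplicative ℤ :=
    FreeGroup.lift fun j => if j = (0 : Fin 2) then Multiplicative.ofAdd (1 : ℤ) else 1
  let σb : FreeGroup (Fin 2) →* Multiplicative ℤ :=
    FreeGroup.lift fun j => if j = (1 : Fin 2) then Multiplicative.ofAdd (1 : ℤ) else 1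
  have hσaa : σa a = Multiplicative.ofAdd 1 := by simp [σa, a]
  have hσab : σa b = 1 := by simp [σa, b]
  have hσba : σb a = 1 := by simp [σb, a]
  have hσbb : σb b = Multiplicative.ofAdd 1 := by simp [σb, b]
  let e : P →ₜ* Zh := (ProfiniteGrp.ProfiniteCompletion.lift (GrpCat.ofHom (ι.comp σa))).hom
  let êb : P →ₜ* Zh := (ProfiniteGrp.ProfiniteCompletion.lift (GrpCat.ofHom (ι.comp σb))).hom
  let îa : Zh →ₜ* P :=
    (ProfiniteGrp.ProfiniteCompletion.lift (GrpCat.ofHom (η.comp (zpowersHom _ a)))).hom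
  let îb : Zh →ₜ* P :=
    (ProfiniteGrp.ProfiniteCompletion.lift (GrpCat.ofHom (η.comp (zpowersHom _ b)))).hom
  have he : ∀ g, e (η g) = ι (σa g) := fun g => lift_hom_toCompletion Zh (ι.comp σa) g
  have hêb : ∀ g, êb (η g) = ι (σb g) := fun g => lift_hom_toCompletion Zh (ι.comp σb) g
  have hîa : ∀ k : ℤ, îa (ι (Multiplicative.ofAdd k)) = η (a ^ k) := fun k => by
    rw [lift_hom_toCompletion P (η.comp (zpowersHom _ a))]
    simp [zpowersHom_apply]
  have hîb : ∀ k : ℤ, îb (ι (Multiplicative.ofAdd k)) = η (b ^ k) := fun k => by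
    rw [lift_hom_toCompletion P (η.comp (zpowersHom _ b))]
    simp [zpowersHom_apply]
  refine ⟨fun U hU => ?_⟩
  refine (Subgroup.eq_bot_iff_forall _).mpr fun z hz => ?_
  -- an open normal `V ≤ U`; `M := η⁻¹ V ⊴ F₂` of finite index `m`
  obtain ⟨V, hVU⟩ := ProfiniteGrp.exist_openNormalSubgroup_sub_open_nhds_of_one hU U.one_mem
  haveI : V.toSubgroup.Normal := V.isNormal'
  let M : Subgroup (FreeGroup (Fin 2)) := V.toSubgroup.comap η
  haveI : M.Normal := Subgroup.Normal.comap inferInstance _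
  haveI hVfi : V.toSubgroup.FiniteIndex := by
    haveI : Finite (P ⧸ V.toSubgroup) := inferInstance
    exact Subgroup.finiteIndex_of_finite_quotient
  have hMfi : M.FiniteIndex := by
    refine ⟨fun h0 => ?_⟩
    have hd := Subgroup.relIndex_dvd_index_of_normal V.toSubgroup η.range
    rw [← Subgroup.index_comap] at hd
    exact hVfi.index_ne_zero (Nat.eq_zero_of_zero_dvd (h0 ▸ hd))
  let m : ℤ := M.index
  have hm : m ≠ 0 := by change (M.index : ℤ) ≠ 0; exact_mod_cast hMfi.index_ne_zero
  have hbm : b ^ m ∈ M := by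
    change b ^ ((M.index : ℕ) : ℤ) ∈ M; rw [zpow_natCast]; exact M.pow_index_mem b
  have habm : a * b ^ m * a⁻¹ ∈ M := Subgroup.Normal.conj_mem inferInstance _ hbm a
  -- the two test elements of `U`
  have hw₁U : η (b ^ m) ∈ U := hVU hbm
  have hw₂U : η (a * b ^ m * a⁻¹) ∈ U := hVU habm
  have hc₁ : η (b ^ m) * z = z * η (b ^ m) := Subgroup.mem_centralizer_iff.mp hz _ hw₁U
  have hc₂ : η (a * b ^ m * a⁻¹) * z = z * η (a * b ^ m * a⁻¹) :=
    Subgroup.mem_centralizer_iff.mp hz _ hw₂U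
  -- hence `z ∈ cl η⟨b⟩ ⊆ range îb` and `(η a)⁻¹ z (η a) ∈ cl η⟨b⟩ ⊆ range îb`
  have hB : ∀ y : P, η (b ^ m) * y = y * η (b ^ m) → ∃ t, îb t = y := by
    intro y hy
    have hy' : y ∈ Subgroup.centralizer ({η (b ^ m)} : Set P) :=
      Subgroup.mem_centralizer_singleton_iff.mpr hy.symm
    exact TemperedFibreProduct.closure_eta_zpowers_subset_range b îb hîb
      (TemperedFibreProduct.centralizer_eta_of_zpow_subset 1 hm hy')
  obtain ⟨t, ht⟩ := hB z hc₁
  have hc₂' : η (b ^ m) * ((η a)⁻¹ * z * η a) = ((η a)⁻¹ * z * η a) * η (b ^ m) := by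
    rw [map_mul, map_mul, map_inv] at hc₂
    have h3 := congrArg (fun w => (η a)⁻¹ * w * η a) hc₂
    calc η (b ^ m) * ((η a)⁻¹ * z * η a)
        = (η a)⁻¹ * (η a * η (b ^ m) * (η a)⁻¹ * z) * η a := by
          simp only [mul_assoc, inv_mul_cancel_left]
      _ = (η a)⁻¹ * (z * (η a * η (b ^ m) * (η a)⁻¹)) * η a := by rw [h3]
      _ = ((η a)⁻¹ * z * η a) * η (b ^ m) := by
          simp only [mul_assoc, inv_mul_cancel, mul_one]
  obtain ⟨t', ht'⟩ := hB _ hc₂'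
  -- evaluate `êb`: `êb (η a) = 1`, `êb ∘ îb = id` ⇒ `t = t'` ⇒ `z` commutes with `η a`
  have hêba : êb (η a) = 1 := by rw [hêb, hσba]; exact map_one _
  have ht_eq : t = t' := by
    have h1 : êb z = t := ht ▸ TemperedFibreProduct.apply_apply_eq_self_of b σb hσbb êb îb hêb hîb t
    have h2 : êb ((η a)⁻¹ * z * η a) = t' := by
      rw [← ht']; exact TemperedFibreProduct.apply_apply_eq_self_of b σb hσbb êb îb hêb hîb t'
    rw [map_mul, map_mul, map_inv, hêba, inv_one, one_mul, mul_one, h1] at h2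
    exact h2
  have hza : η a * z = z * η a := by
    have h4 : (η a)⁻¹ * z * η a = z := by rw [← ht', ← ht_eq, ht]
    calc η a * z = η a * ((η a)⁻¹ * z * η a) := by rw [h4]
      _ = z * η a := by simp only [mul_assoc, mul_inv_cancel_left]
  -- `z ∈ C(η a) = cl η⟨a⟩ ⊆ range îa`
  have hA : ∃ u, îa u = z := by
    have hz' : z ∈ Subgroup.centralizer ({η (a ^ (1 : ℤ))} : Set P) := by
      rw [zpow_one]; exact Subgroup.mem_centralizer_singleton_iff.mpr hza.symm
    exact TemperedFibreProduct.closure_eta_zpowers_subset_range a îa hîa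
      (TemperedFibreProduct.centralizer_eta_of_zpow_subset 0 one_ne_zero hz')
  obtain ⟨u, hu⟩ := hA
  -- evaluate `e`: `e ∘ îa = id`, `e ∘ îb = 1` ⇒ `u = 1` ⇒ `z = 1`
  have hu1 : u = 1 := by
    have h1 : e z = u := hu ▸ TemperedFibreProduct.apply_apply_eq_self_of a σa hσaa e îa he hîa u
    have h2 : e z = 1 := ht ▸ TemperedFibreProduct.apply_apply_eq_one_of b σa hσab e îb he hîb t
    rw [h1] at h2; exact h2
  rw [← hu, hu1, map_one]

/-! ### Products of slim profinite groups -/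

/-- **A product of two slim profinite groups is slim**: an open subgroup `U ≤ P × Q` contains `V × W`
for open (normal) subgroups `V ≤ P`, `W ≤ Q`; an element `(z₁, z₂)` centralising `U` centralises
`V × 1` and `1 × W`, so `z₁ ∈ Z_P(V) = 1` and `z₂ ∈ Z_Q(W) = 1`. ([SemiAnbd] §0 / Ex. 3.10 "slim".)
[cite: MochizukiSemiAnbd2006, Ex 3.10 p.45] -/
theorem isSlimGroup_prod_of_profinite {P Q : Type*} [Group P] [TopologicalSpace P]
    [IsTopologicalGroup P] [CompactSpace P] [TotallyDisconnectedSpace P]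
    [Group Q] [TopologicalSpace Q] [IsTopologicalGroup Q] [CompactSpace Q] [TotallyDisconnectedSpace Q]
    (hP : IsSlimGroup P) (hQ : IsSlimGroup Q) : IsSlimGroup (P × Q) := by
  refine ⟨fun U hU => ?_⟩
  refine (Subgroup.eq_bot_iff_forall _).mpr fun z hz => ?_
  have h1 : (U : Set (P × Q)) ∈ 𝓝 ((1 : P), (1 : Q)) := hU.mem_nhds U.one_mem
  obtain ⟨u, v, hu, h1u, hv, h1v, huv⟩ := mem_nhds_prod_iff'.mp h1
  obtain ⟨V, hV⟩ := ProfiniteGrp.exist_openNormalSubgroup_sub_open_nhds_of_one hu h1u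
  obtain ⟨W, hW⟩ := ProfiniteGrp.exist_openNormalSubgroup_sub_open_nhds_of_one hv h1v
  have hVo : IsOpen ((V.toSubgroup : Subgroup P) : Set P) := V.toOpenSubgroup.isOpen
  have hWo : IsOpen ((W.toSubgroup : Subgroup Q) : Set Q) := W.toOpenSubgroup.isOpen
  have hz1 : z.1 ∈ Subgroup.centralizer ((V.toSubgroup : Subgroup P) : Set P) := by
    refine Subgroup.mem_centralizer_iff.mpr fun g hg => ?_
    have hgu : g ∈ u := hV hg
    have hgU : ((g, 1) : P × Q) ∈ U := huv ⟨hgu, h1v⟩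
    have := Subgroup.mem_centralizer_iff.mp hz _ hgU
    simpa using congrArg Prod.fst this
  have hz2 : z.2 ∈ Subgroup.centralizer ((W.toSubgroup : Subgroup Q) : Set Q) := by
    refine Subgroup.mem_centralizer_iff.mpr fun g hg => ?_
    have hgv : g ∈ v := hW hg
    have hgU : ((1, g) : P × Q) ∈ U := huv ⟨h1u, hgv⟩
    have := Subgroup.mem_centralizer_iff.mp hz _ hgU
    simpa using congrArg Prod.snd this
  rw [hP.centralizer_eq_bot _ hVo] at hz1
  rw [hQ.centralizer_eq_bot _ hWo] at hz2
  exact Prod.ext (Subgroup.mem_bot.mp hz1) (Subgroup.mem_bot.mp hz2)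

/-- Slimness is transported along isomorphisms of topological groups (bookkeeping; a private copy of
the tree's lemma of the same content). [folklore] -/
private theorem isSlimGroup_of_continuousMulEquiv₂ {G₁ G₂ : Type*} [Group G₁] [TopologicalSpace G₁]
    [Group G₂] [TopologicalSpace G₂] (e : G₁ ≃ₜ* G₂) (h : IsSlimGroup G₁) : IsSlimGroup G₂ := by
  refine ⟨fun H hH => ?_⟩
  refine (Subgroup.eq_bot_iff_forall _).mpr fun z hz => ?_
  have hH' : IsOpen ((H.comap e.toMulEquiv.toMonoidHom : Subgroup G₁) : Set G₁) :=
    hH.preimage e.continuous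
  have hz' : e.symm z ∈ Subgroup.centralizer ((H.comap e.toMulEquiv.toMonoidHom : Subgroup G₁) : Set G₁) := by
    refine Subgroup.mem_centralizer_iff.mpr fun g hg => ?_
    have := Subgroup.mem_centralizer_iff.mp hz (e g) hg
    apply e.injective
    simpa [map_mul] using this
  rw [h.centralizer_eq_bot _ hH'] at hz'
  have : e.symm z = 1 := Subgroup.mem_bot.mp hz'
  simpa using congrArg e this

/-! ### The witness -/

/-- **A §6 datum with GENUINE arithmetic part, NONABELIAN SLIM geometric part and a cusp, carrying
`GroupLevelData` unconditionally** ([SemiAnbd] §6 pp. 69–71 interface `TemperedCurve p`; Ex. 3.10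
parameter bundle of abc-iut-w5-d111's bridge): there is `X : TemperedCurve p` with base field `K = ℚ_p`
(so `G_K = G_{ℚ_p}`: `aug` is ONTO `G_{ℚ_p}`), `Π^temp := G_{ℚ_p} × F̂₂`, `Δ^temp = 1 × F̂₂` NONABELIAN
and SLIM, `Π^temp` slim, ONE closed point which is a CUSP (`D_x = G_{ℚ_p} × îa(Ẑ)`, `I_x ≅ Ẑ`), and
`Nonempty X.GroupLevelData` — whence, through the bridge, a `TemperedArithmeticGroup` of Ex. 3.10 over
`X.K = ℚ_p` with nonabelian slim `Δ`.  Honest limits in the module docstring (direct product; compact;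
not a curve). [cite: MochizukiSemiAnbd2006, §6 pp.69-71] -/
theorem exists_temperedCurve_groupLevelData_genuine (p : ℕ) [Fact p.Prime] :
    ∃ X : TemperedCurve p,
      X.K = ⊥ ∧ Function.Surjective X.aug ∧
      Nonempty X.GroupLevelData ∧
      (∃ x : X.Pt, X.IsCusp x) ∧
      (∃ g ∈ X.DeltaTemp, ∃ h ∈ X.DeltaTemp, g * h ≠ h * g) ∧
      IsSlimGroup X.PiTemp ∧ IsSlimGroup X.DeltaTemp ∧ CompactSpace X.PiTemp ∧
      (∃ d : X.GroupLevelData, (X.toTemperedArithmeticGroup d).Pi = X.PiTemp ∧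
        ∃ g ∈ (X.toTemperedArithmeticGroup d).delta, ∃ h ∈ (X.toTemperedArithmeticGroup d).delta,
          g * h ≠ h * g) := by
  classical
  -- instances on `G_{ℚ_p}`
  haveI : IsGalois ℚ_[p] (AlgebraicClosure ℚ_[p]) := {}
  haveI : T2Space (GQp p) := krullTopology_t2
  -- the profinite data (abc-iut-w5-d218's toolkit)
  let P : ProfiniteGrp.{0} := profiniteCompletion (FreeGroup (Fin 2))
  let Zh : ProfiniteGrp.{0} := profiniteCompletion (Multiplicative ℤ)
  let η : FreeGroup (Fin 2) →* P := toCompletion (FreeGroup (Fin 2))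
  let ι : Multiplicative ℤ →* Zh := toCompletion (Multiplicative ℤ)
  let a : FreeGroup (Fin 2) := FreeGroup.of 0
  let b : FreeGroup (Fin 2) := FreeGroup.of 1
  let σa : FreeGroup (Fin 2) →* Multiplicative ℤ :=
    FreeGroup.lift fun j => if j = (0 : Fin 2) then Multiplicative.ofAdd (1 : ℤ) else 1
  have hσaa : σa a = Multiplicative.ofAdd 1 := by simp [σa, a]
  have hσab : σa b = 1 := by simp [σa, b]
  let e : P →ₜ* Zh := (ProfiniteGrp.ProfiniteCompletion.lift (GrpCat.ofHom (ι.comp σa))).hom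
  let îa : Zh →ₜ* P :=
    (ProfiniteGrp.ProfiniteCompletion.lift (GrpCat.ofHom (η.comp (zpowersHom _ a)))).hom
  let îb : Zh →ₜ* P :=
    (ProfiniteGrp.ProfiniteCompletion.lift (GrpCat.ofHom (η.comp (zpowersHom _ b)))).hom
  have he : ∀ g, e (η g) = ι (σa g) := fun g => lift_hom_toCompletion Zh (ι.comp σa) g
  have hîa : ∀ k : ℤ, îa (ι (Multiplicative.ofAdd k)) = η (a ^ k) := fun k => by
    rw [lift_hom_toCompletion P (η.comp (zpowersHom _ a))]
    simp [zpowersHom_apply]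
  have hîb : ∀ k : ℤ, îb (ι (Multiplicative.ofAdd k)) = η (b ^ k) := fun k => by
    rw [lift_hom_toCompletion P (η.comp (zpowersHom _ b))]
    simp [zpowersHom_apply]
  have heîa : ∀ t, e (îa t) = t := TemperedFibreProduct.apply_apply_eq_self_of a σa hσaa e îa he hîa
  have hιinj : Function.Injective ι := toCompletion_int_injective
  -- `η a` and `η b` do not commute: else `η a ∈ C(η b) ⊆ îb(Ẑ)`, and `e` kills `îb(Ẑ)` but not `η a`
  have hnc : η a * η b ≠ η b * η a := by
    intro hab
    have hz' : η a ∈ Subgroup.centralizer ({η (b ^ (1 : ℤ))} : Set P) := by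
      rw [zpow_one]; exact Subgroup.mem_centralizer_singleton_iff.mpr hab
    obtain ⟨t, ht⟩ := TemperedFibreProduct.closure_eta_zpowers_subset_range b îb hîb
      (TemperedFibreProduct.centralizer_eta_of_zpow_subset 1 one_ne_zero hz')
    have h1 : e (η a) = ι (Multiplicative.ofAdd 1) := by rw [he, hσaa]
    have h2 : e (η a) = 1 := by
      rw [← ht]; exact TemperedFibreProduct.apply_apply_eq_one_of b σa hσab e îb he hîb t
    rw [h1, ← map_one ι] at h2
    exact absurd (hιinj h2) (by decide)
  -- the group `Π := G_{ℚ_p} × F̂₂`, the inertia `I := îa(Ẑ)` and the decomposition group `D := G_{ℚ_p} × I`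
  let I : Subgroup P := îa.toMonoidHom.range
  have hIclosed : IsClosed (I : Set P) := by
    have : (I : Set P) = Set.range îa := by ext x; simp [I]
    rw [this]; exact (isCompact_range îa.continuous).isClosed
  let D : Subgroup (GQp p × P) := (⊤ : Subgroup (GQp p)).prod I
  have hDmem : ∀ x : GQp p × P, x ∈ D ↔ x.2 ∈ I := fun x => by simp [D, Subgroup.mem_prod]
  have hDclosed : IsClosed (D : Set (GQp p × P)) := by
    have : (D : Set (GQp p × P)) = Prod.snd ⁻¹' (I : Set P) := by
      ext x; exact hDmem x
    rw [this]; exact hIclosed.preimage continuous_snd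
  let fstH : GQp p × P →ₜ* GQp p := ContinuousMonoidHom.fst _ _
  have hfstD : fstH '' (D : Set (GQp p × P)) = Set.univ :=
    Set.eq_univ_of_forall fun g => ⟨(g, 1), (hDmem _).2 I.one_mem, rfl⟩
  -- the inertia `D ∩ Ker(pr₁) = 1 × îa(Ẑ) ≃ₜ* Ẑ` via `ê_a` (left inverse of `îa`)
  have hinertia : Nonempty (↥(D ⊓ fstH.toMonoidHom.ker) ≃ₜ* ZHat) := by
    refine ⟨{ toFun := fun x => e x.1.2
              invFun := fun t => ⟨(1, îa t), (hDmem _).2 ⟨t, rfl⟩, (MonoidHom.mem_ker).2 rfl⟩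
              left_inv := fun x => ?_
              right_inv := fun t => heîa t
              map_mul' := fun x y => by
                change e ((x : GQp p × P) * y).2 = e (x : GQp p × P).2 * e (y : GQp p × P).2
                rw [Prod.snd_mul, map_mul]
              continuous_toFun := e.continuous.comp (continuous_snd.comp continuous_subtype_val)
              continuous_invFun := (continuous_const.prodMk îa.continuous).subtype_mk _ }⟩
    obtain ⟨⟨g, z⟩, hgz⟩ := x
    have hg : g = 1 := (MonoidHom.mem_ker).1 (Subgroup.mem_inf.1 hgz).2
    obtain ⟨u, hu⟩ : z ∈ I := (hDmem _).1 (Subgroup.mem_inf.1 hgz).1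
    apply Subtype.ext
    change ((1 : GQp p), îa (e z)) = (g, z)
    rw [hg, ← hu]
    exact Prod.ext rfl (congrArg îa (heîa u))
  -- the curve-level datum
  let X : TemperedCurve p :=
    { K := ⊥
      finiteDimensional_K := inferInstance
      PiTemp := GQp p × P
      aug := fstH
      range_aug := by
        rw [IntermediateField.fixingSubgroup_bot]
        exact MonoidHom.range_eq_top.mpr Prod.fst_surjective
      PiHat := GQp p × P
      toHat := ContinuousMonoidHom.id _
      isProfiniteCompletion_toHat := isProfiniteCompletion_id _
      toHat_injective := Function.injective_id
      augHat := fstH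
      augHat_comp := fun _ => rfl
      Pt := Unit
      IsCusp := fun _ => True
      decomp := fun _ => D
      isClosed_decomp := fun _ => hDclosed
      isOpen_aug_decomp := fun _ => by
        change IsOpen (fstH '' (D : Set (GQp p × P)))
        rw [hfstD]; exact isOpen_univ
      inertia_eq_bot := fun _ h => (h trivial).elim
      inertia_equiv_zHat := fun _ _ => hinertia }
  -- group-level facts about `Π = G_{ℚ_p} × F̂₂`
  have hT : IsTempered (GQp p × P) := IsTempered.of_profinite
  have hslimP : IsSlimGroup P := isSlimGroup_profiniteCompletion_freeGroupTwo
  have hslimG : IsSlimGroup (GQp p) := IsSubpadicFor.isSlimGroup_absoluteGaloisGroup (AbsTopIII.IsSubpadicFor.padic p)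
  have hslim : IsSlimGroup (GQp p × P) := isSlimGroup_prod_of_profinite hslimG hslimP
  haveI hscG : SecondCountableTopology (GQp p) :=
    Literature.NumberTheory.LocalFields.secondCountableTopology_galQp p
  haveI hscP : SecondCountableTopology P := secondCountableTopology_profiniteCompletion_freeGroup (Fin 2)
  have hsc : SecondCountableTopology (GQp p × P) := inferInstance
  -- `Δ^temp = Ker(pr₁) = 1 × F̂₂ ≃ₜ* F̂₂`
  have hΔmem : ∀ x : GQp p × P, x ∈ X.DeltaTemp ↔ x.1 = 1 := fun x => MonoidHom.mem_ker
  have eΔ : ∀ (H : Subgroup (GQp p × P)), (∀ x, x ∈ H ↔ x.1 = 1) → Nonempty (P ≃ₜ* H) :=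
    fun H hH =>
      ⟨{ toFun := fun z => ⟨(1, z), (hH _).2 rfl⟩
         invFun := fun y => y.1.2
         left_inv := fun z => rfl
         right_inv := fun y => by
           apply Subtype.ext
           exact Prod.ext ((hH _).1 y.2).symm rfl
         map_mul' := fun z w => Subtype.ext (Prod.ext (by simp) rfl)
         continuous_toFun := (continuous_const.prodMk continuous_id).subtype_mk _
         continuous_invFun := continuous_snd.comp continuous_subtype_val }⟩
  have hslimΔ : IsSlimGroup X.DeltaTemp := by
    obtain ⟨eH⟩ := eΔ X.DeltaTemp hΔmem
    exact isSlimGroup_of_continuousMulEquiv₂ eH hslimP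
  -- the `GroupLevelData`
  let ιG := X.galoisIdentification
  have hkermem : ∀ x : GQp p × P, x ∈ (X.augK ιG).toMonoidHom.ker ↔ x.1 = 1 := fun x => by
    rw [TemperedCurve.ker_augK]; exact hΔmem x
  have hkerClosed : IsClosed (((X.augK ιG).toMonoidHom.ker : Subgroup (GQp p × P)) : Set (GQp p × P)) := by
    have : (((X.augK ιG).toMonoidHom.ker : Subgroup (GQp p × P)) : Set (GQp p × P)) =
        Prod.fst ⁻¹' {1} := by
      ext x; exact hkermem x
    rw [this]; exact isClosed_singleton.preimage continuous_fst
  have hslimKer : IsSlimGroup (X.augK ιG).toMonoidHom.ker := by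
    obtain ⟨eH⟩ := eΔ _ hkermem
    exact isSlimGroup_of_continuousMulEquiv₂ eH hslimP
  let d : X.GroupLevelData :=
    { galEquiv := ιG
      isTempered := hT
      isTempered_ker := hT.subgroup_of_isClosed _ hkerClosed
      isSlimGroup := hslim
      isSlimGroup_ker := hslimKer
      secondCountableTopology := hsc }
  have hg : ((1 : GQp p), η a) ∈ X.DeltaTemp := (hΔmem _).2 rfl
  have hh : ((1 : GQp p), η b) ∈ X.DeltaTemp := (hΔmem _).2 rfl
  have hgh : ((1 : GQp p), η a) * ((1 : GQp p), η b) ≠ ((1 : GQp p), η b) * ((1 : GQp p), η a) :=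
    fun hc => hnc (by simpa using congrArg Prod.snd hc)
  refine ⟨X, rfl, Prod.fst_surjective, ⟨d⟩, ⟨(), trivial⟩, ⟨_, hg, _, hh, hgh⟩, hslim, hslimΔ,
    (inferInstance : CompactSpace (GQp p × P)), d, rfl, ?_⟩
  rw [TemperedCurve.toTemperedArithmeticGroup_delta]
  exact ⟨_, hg, _, hh, hgh⟩

end Literature.AnabelianGeometry.SemiGraphs

end
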